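/-
Copyright (c) 2026 the pub-hodgecm-mathlib formalisation cell (harness21).  Prover seat hodgecm-mathlib-LH4-p06 (g2): Track A «(D-RAM) FOUR-FRAME» squad of crux H413
(dealer LH4-plan (g10) WORD #51∕#53∕#56: U2H ED. 7, child (ρ3′) «ROW (3) of (ρ) at the explicit coefficient vector coef*»; REF5 R5-46 «no ∃-socket»), 2026-09-03.
-/
import Summits.HodgeConjecture.HodgeConjecture.Theorems.F0P3cDyRamHFamilySmooth       -- ★ p854867 (LH4-p05): `isLocSmooth_hFamily` (the profiles are locally constant with compact support) + DEFS LEAF №5 `hFamily`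
import Summits.HodgeConjecture.HodgeConjecture.Theorems.F0P3cDyRamFourFrameLawDefsR    -- ★ p855104-side №1-R: `shiftR` (the exponent `S` of coef*)
import Literature.NumberTheory.Rogawski1990.UnitStableOrbitalIntegralHSideLevelValueOfIsRoot   -- ★ `isCompact_and_interior_nonempty_prod_cmLocalIntegralLevel` (`νH(K_H) ≠ 0`)
import HarnessLib

/-!
# F0 · P3c · line LH4 «(D-RAM) FOUR-FRAME» — unit (ii-H), child (ρ3′): ROW (3) OF THE ROWS SOCKET (ρ) AT THE EXPLICIT COEFFICIENTS, REDUCED TO (ρ3a) ∧ (ρ3b′) ∧ (ρ3c)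
(Rogawski 1990 §4.9 Prop. 4.9.1 (b), Lemma 4.9.2; §4.3 (4.3.1))

Cell `pub/hodgecm-mathlib`, crux H413 = `stmt-HodgeConjecture-24833` (helper lane), route HCCMUnconditional; THEOREMS ONLY (no definition, no instance, no notation, no named
fact, no `sorry`).  Tree socket served: (ρ3′) `F0P3cDyRamFourFrameU2H.stub_U2H_rowThree_unit0` of `Cruxes/H413/Lines/F0_P3c_DyRamFourFrame_U2H_HSide.lean` ED. 7 (LH4-p06 (g2) cand
2bbef6bde5fbb0f0): ROW (3) of (ρ) `stub_U2H_rowsR_hFamily_unit0` with `coef s ↦ coef* s`, the law₁ solution (LH4-p12 (g0), REF5 R5-46, dealer WORD #53 (A))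
`coef* s = (if s = s_V then C(q+1−2q^S) else 2C(q^S−1)) ∕ ((q−1)·ν_s)`, `s_V = d % 2`, `ν_s = νH(supp hFamily s)`, `q = #k_w`, `S = shiftR d t_E`.

THE MATHEMATICS (LH4-p06 (g2) ν-reconciliation, dealer WORD #56 «=»).  On the Levi population near `1 ∈ H_v` the three children say
(ρ3a) `Σᶠ_c Δ‴(γ_H, out c)·Φ(c, 1_{K_t}) = (νG₃(K_t)∕νH(K_H))·Φ^st(γ_H, h₀)`, (ρ3b′) `ν_0·Φ^st(γ_H, h₁) = ν_1·Φ^st(γ_H, h₀)` (`ν_0 = νH(K_H)`), (ρ3c) `C = νG₃(K_t)`.  Hence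
`Σ_s coef*_s·Φ^st(γ_H, h_s) = (coef*_0·ν_0 + coef*_1·ν_1)∕ν_0 · Φ^st(γ_H, h₀) = (C∕ν_0)·Φ^st(γ_H, h₀)` — because `coef*_s·ν_s` are the two numerators over `q − 1`, whose sum is
`C((q+1−2q^S) + 2(q^S−1))∕(q−1) = C` IDENTICALLY (whichever profile is the vertex one) — `= (νG₃(K_t)∕νH(K_H))·Φ^st(γ_H, h₀) = Σᶠ_c Δ‴·Φ(c, 1_{K_t})`: ROW (3) at coef*.  Inputs used:
`ν_0, ν_1 ≠ 0` (supports of the two profiles are open neighbourhoods of `1`, ★ `isLocSmooth_hFamily`; Haar), `q ≥ 2`.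

* §1 `exists_nhds_forall_eq_sum_two_of_ratio` (generic: two germs + one scalar identity ⇒ the row germ).
* §2 `support_hFamily_zero`, `one_mem_support_hFamily_one`, `measureReal_support_hFamily_ne_zero` (the volumes `ν_s` are non-zero reals), `sum_coefStar_mul_eq` (`Σ_s coef*_s·ν_s = C`).
* §3 HEAD **`rowThree_of_leviClause_of_ratio_of_const`** — ROW (3) of (ρ) at coef* VERBATIM from the conclusions of (ρ3a), (ρ3b′), (ρ3c).

HONEST LABEL: HC_CM is proved only modulo the 7 printed citations (2 remaining named inputs: hLiu418 = stmt-HodgeConjecture-24832, h413 = stmt-HodgeConjecture-24833) until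
rung 0 closes; this file is unconditional and count-neutral (a reduction; the children (ρ3b′), (ρ3c) stay sorried targets in the line file until paid).

## References
* [Rogawski1990] J. D. Rogawski, *Automorphic Representations of Unitary Groups in Three Variables*, Ann. of Math. Stud. 123 (1990): §4.9 Prop. 4.9.1 (b) p. 55,
  Lemma 4.9.2 p. 56; §4.3 (4.3.1) p. 43.
-/

set_option autoImplicit false

noncomputable section

open scoped Topology
open MeasureTheory Measure NumberField IsDedekindDomain Matrix Filter
open Literature.NumberTheory.Automorphic Literature.NumberTheory.Automorphic.UnitaryGroup
open Literature.NumberTheory.Rogawski1990 Literature.NumberTheory.GaloisRepresentations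
open Summit.HodgeConjecture.HodgeConjecture.Cruxes.H413.F0P3cDyRamFourFrameHFamilyDefs
open Summit.HodgeConjecture.HodgeConjecture.Cruxes.H413.F0P3cDyRamFourFrameLawDefsR (shiftR)

namespace Summit.HodgeConjecture.HodgeConjecture.Cruxes.H413.F0P3cDyRamRowThreeReduction

/-! ## §1 Generic: two germs and one scalar identity give the row germ -/

/-- **Two germs + one scalar identity ⇒ the row germ.**  If near `x₀`, on the population `P ∧ Q`, `lhs = (G∕ν₀)·Φ₀` and `ν₀·Φ₁ = ν₁·Φ₀` (`ν₀ ≠ 0`), and the coefficients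
satisfy `c₀ν₀ + c₁ν₁ = G`, then near `x₀` on that population `lhs = Σ_s c_s·Φ_s`. [cite: Rogawski1990, §4.3 (4.3.1) p. 43] -/
theorem exists_nhds_forall_eq_sum_two_of_ratio {X : Type*} [TopologicalSpace X] {x₀ : X} {P Q : X → Prop}
    {lhs : X → ℂ} {Φ : Fin 2 → X → ℂ} {coef : Fin 2 → ℂ} {G ν₀ ν₁ : ℂ} (hν₀ : ν₀ ≠ 0)
    (hA : ∃ V ∈ 𝓝 x₀, ∀ x ∈ V, P x → Q x → lhs x = G / ν₀ * Φ 0 x)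
    (hR : ∃ V ∈ 𝓝 x₀, ∀ x ∈ V, P x → Q x → ν₀ * Φ 1 x = ν₁ * Φ 0 x)
    (hc : coef 0 * ν₀ + coef 1 * ν₁ = G) :
    ∃ V ∈ 𝓝 x₀, ∀ x ∈ V, P x → Q x → lhs x = ∑ s, coef s * Φ s x := by
  obtain ⟨V₁, hV₁, h₁⟩ := hA
  obtain ⟨V₂, hV₂, h₂⟩ := hR
  refine ⟨V₁ ∩ V₂, inter_mem hV₁ hV₂, fun x hx hP hQ => ?_⟩
  have e₁ := h₁ x hx.1 hP hQ
  have e₂ := h₂ x hx.2 hP hQ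
  have e₂' : Φ 1 x = ν₁ / ν₀ * Φ 0 x := by
    rw [div_mul_eq_mul_div, eq_div_iff hν₀, mul_comm, e₂]
  rw [Fin.sum_univ_two, e₁, e₂', ← hc]
  field_simp

/-! ## §2 The two volumes and the coefficient identity -/

section CM

variable (L : Type) [Field L] [NumberField L] [IsCMField L] {v : HeightOneSpectrum (𝓞 ↥(maximalRealSubfield L))}
  (w : PlacesOver L v) (hw : IsCMField.complexConj L • w.1 = w.1)

/-- `supp hFamily … 0 = K_H` (the indicator of `K_H`). [cite: Rogawski1990, §4.9 p. 54] -/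
theorem support_hFamily_zero (ϖ : w.1.adicCompletion L) :
    Function.support (hFamily L w hw ϖ 0) =
      ((((cmLocalIntegralLevel L 2 (Matrix.of fun i j : Fin 2 => if i.val + j.val + 1 = 2 then (1 : L) else 0) v).prod
        (cmLocalIntegralLevel L 1 (Matrix.of fun i j : Fin 1 => if i.val + j.val + 1 = 1 then (1 : L) else 0) v)) : Subgroup _) : Set _) := by
  show Function.support (hProfileZero L v) = _
  rw [hProfileZero, Set.support_indicator, Function.support_const one_ne_zero, Set.inter_univ]

include hw in
/-- **The volumes `ν_s = νH(supp hFamily s)` are non-zero** (`s = 0, 1`): each profile is the indicator of a compact OPEN subgroup containing `1` (★ `isLocSmooth_hFamily`: locally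
constant with compact support; `hFamily … s 1 = 1`), and a Haar measure is positive on non-empty open sets and finite on compact ones. [cite: Rogawski1990, §4.9 p. 54] -/
theorem measureReal_support_hFamily_ne_zero (he : v.asIdeal.ramificationIdx' w.1.asIdeal ≠ 1)
    (ϖ : w.1.adicCompletion L) (hϖ : Valued.v ϖ = WithZero.exp (-1 : ℤ))
    [MeasurableSpace ((cmDatum L 2 (Matrix.of fun i j : Fin 2 => if i.val + j.val + 1 = 2 then (1 : L) else 0)).Local v ×
      (cmDatum L 1 (Matrix.of fun i j : Fin 1 => if i.val + j.val + 1 = 1 then (1 : L) else 0)).Local v)]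
    [BorelSpace ((cmDatum L 2 (Matrix.of fun i j : Fin 2 => if i.val + j.val + 1 = 2 then (1 : L) else 0)).Local v ×
      (cmDatum L 1 (Matrix.of fun i j : Fin 1 => if i.val + j.val + 1 = 1 then (1 : L) else 0)).Local v)]
    (νH : Measure ((cmDatum L 2 (Matrix.of fun i j : Fin 2 => if i.val + j.val + 1 = 2 then (1 : L) else 0)).Local v ×
      (cmDatum L 1 (Matrix.of fun i j : Fin 1 => if i.val + j.val + 1 = 1 then (1 : L) else 0)).Local v)) [νH.IsHaarMeasure]
    (s : Fin 2) : (νH.real (Function.support (hFamily L w hw ϖ s)) : ℂ) ≠ 0 := by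
  have hsm := F0P3cDyRamHFamilySmooth.isLocSmooth_hFamily L w hw he ϖ hϖ s
  -- the support is open (locally constant) and compact-closure (compact support), and contains `1`
  have hopen : IsOpen (Function.support (hFamily L w hw ϖ s)) := by
    rw [Function.support, show {x | hFamily L w hw ϖ s x ≠ 0} = (hFamily L w hw ϖ s ⁻¹' {0})ᶜ from rfl, isOpen_compl_iff]
    exact (hsm.1.isClopen_fiber 0).isClosed
  have h1 : (1 : (cmDatum L 2 (Matrix.of fun i j : Fin 2 => if i.val + j.val + 1 = 2 then (1 : L) else 0)).Local v ×
      (cmDatum L 1 (Matrix.of fun i j : Fin 1 => if i.val + j.val + 1 = 1 then (1 : L) else 0)).Local v) ∈ Function.support (hFamily L w hw ϖ s) := by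
    rw [Function.mem_support]
    fin_cases s
    · show hProfileZero L v 1 ≠ 0
      rw [hProfileZero, Set.indicator_of_mem (by exact one_mem _)]
      exact one_ne_zero
    · show hProfileSharp L w hw ϖ 1 ≠ 0
      rw [hProfileSharp, Set.indicator_of_mem]
      · exact one_ne_zero
      · intro a b
        have h1 := map_one (localNonsplitEquiv (IsCMField.complexConj L) (Matrix.of fun i j : Fin 2 => if i.val + j.val + 1 = 2 then (1 : L) else 0)
          (IsCMField.complexConj_ne_one L) w hw)
        rw [Prod.fst_one]
        erw [h1]
        rw [OneMemClass.coe_one, Units.val_one]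
        by_cases hab : a = b
        · subst hab
          rw [Matrix.one_apply_eq, mul_one, mul_inv_cancel₀ (pow_ne_zero _ (by
            intro h; rw [h, map_zero] at hϖ; exact WithZero.zero_ne_coe hϖ))]
          rw [map_one]
        · rw [Matrix.one_apply_ne hab, mul_zero, map_zero]
          exact zero_le_one
  have hpos : 0 < νH (Function.support (hFamily L w hw ϖ s)) := hopen.measure_pos νH ⟨1, h1⟩
  have htop : νH (Function.support (hFamily L w hw ϖ s)) < ⊤ :=
    (hsm.2.isCompact.measure_lt_top (μ := νH)).trans_le' (measure_mono subset_closure)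
  rw [Ne, Complex.ofReal_eq_zero, measureReal_def, ENNReal.toReal_eq_zero_iff, not_or]
  exact ⟨hpos.ne', htop.ne⟩

/-- **`Σ_s coef*_s · ν_s = C`** — the two numerators of coef* sum to `C(q − 1)` whichever profile is the vertex one (`q ≠ 1`, `ν_s ≠ 0`). [cite: Rogawski1990, §4.9 p. 55] -/
theorem sum_coefStar_mul_eq {C q ν₀ ν₁ : ℂ} (hq : q - 1 ≠ 0) (hν₀ : ν₀ ≠ 0) (hν₁ : ν₁ ≠ 0) (d : ℕ) (S : ℤ) :
    (if ((0 : Fin 2) : ℕ) = d % 2 then C * ((q + 1) - 2 * q ^ S) else 2 * C * (q ^ S - 1)) / ((q - 1) * ν₀) * ν₀ +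
      (if ((1 : Fin 2) : ℕ) = d % 2 then C * ((q + 1) - 2 * q ^ S) else 2 * C * (q ^ S - 1)) / ((q - 1) * ν₁) * ν₁ = C := by
  rcases Nat.mod_two_eq_zero_or_one d with hd | hd
  · simp only [hd, Fin.val_zero, Fin.val_one, if_true, one_ne_zero, if_false]
    field_simp
    ring
  · simp only [hd, Fin.val_zero, Fin.val_one, zero_ne_one, if_false, if_true]
    field_simp
    ring

end CM

/-! ## §3 HEAD: ROW (3) of (ρ) at coef*, from (ρ3a), (ρ3b′), (ρ3c) -/

section Head

variable (L : Type) [Field L] [NumberField L] [IsCMField L] {v : HeightOneSpectrum (𝓞 ↥(maximalRealSubfield L))}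
  (w : PlacesOver L v) (hw : IsCMField.complexConj L • w.1 = w.1)

include hw in
open scoped Classical in
/-- **ROW (3) OF (ρ) AT THE EXPLICIT COEFFICIENTS, FROM ITS THREE CHILDREN** — the payer of `stub_U2H_rowThree_unit0` (U2H ED. 7): given the conclusions of (ρ3a)
`stub_U2H_leviClause_unit0` (`h3a`), (ρ3b′) `stub_U2H_hProfiles_levi_ratio_wild` (`h3b`) and (ρ3c) `stub_U2H_censusConstant_unit0` (`h3c`) at the (ρ) binders, ROW (3) of
`stub_U2H_rowsR_hFamily_unit0` holds with `coef s ↦ coef* s` — TOKEN FOR TOKEN the conclusion of (ρ3′).  Pay line in the line file: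
`stub_U2H_rowThree_unit0 := fun L _ _ _ _ w hw he h2 ϖ hϖ d tE hD _ δ hδ hδ0 μ hμu hμω _ _ _ _ _ _ _ _ νH _ _ νG₃ _ _ mH mG₃ hmH hmG N hN Kt hKt C hC =>
rowThree_of_leviClause_of_ratio_of_const L w hw he ϖ hϖ d tE μ νH νG₃ mH mG₃ Kt C (stub_U2H_leviClause_unit0 …) (stub_U2H_hProfiles_levi_ratio_wild …) (stub_U2H_censusConstant_unit0 …)`.
[cite: Rogawski1990, §4.9 Prop. 4.9.1 (b) p. 55, Lemma 4.9.2 p. 56; §4.3 (4.3.1) p. 43] -/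
theorem rowThree_of_leviClause_of_ratio_of_const (he : v.asIdeal.ramificationIdx' w.1.asIdeal ≠ 1)
    (ϖ : w.1.adicCompletion L) (hϖ : Valued.v ϖ = WithZero.exp (-1 : ℤ)) (d tE : ℕ)
    [Fintype (Valued.ResidueField (w.1.adicCompletion L))]
    (μ : HeckeCharacter L)
    [MeasurableSpace ((UnitaryGroup.cmDatum L 3 (Matrix.of fun i j : Fin 3 => if i.val + j.val + 1 = 3 then (1 : L) else 0)).Local v)]
    [∀ γ : ((UnitaryGroup.cmDatum L 3 (Matrix.of fun i j : Fin 3 => if i.val + j.val + 1 = 3 then (1 : L) else 0)).Local v), MeasurableSpace (((UnitaryGroup.cmDatum L 3 (Matrix.of fun i j : Fin 3 => if i.val + j.val + 1 = 3 then (1 : L) else 0)).Local v) ⧸ Subgroup.centralizer ({γ} : Set ((UnitaryGroup.cmDatum L 3 (Matrix.of fun i j : Fin 3 => if i.val + j.val + 1 = 3 then (1 : L) else 0)).Local v)))]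
    [MeasurableSpace ((UnitaryGroup.cmDatum L 2 (Matrix.of fun i j : Fin 2 => if i.val + j.val + 1 = 2 then (1 : L) else 0)).Local v × (UnitaryGroup.cmDatum L 1 (Matrix.of fun i j : Fin 1 => if i.val + j.val + 1 = 1 then (1 : L) else 0)).Local v)]
    [BorelSpace ((UnitaryGroup.cmDatum L 2 (Matrix.of fun i j : Fin 2 => if i.val + j.val + 1 = 2 then (1 : L) else 0)).Local v × (UnitaryGroup.cmDatum L 1 (Matrix.of fun i j : Fin 1 => if i.val + j.val + 1 = 1 then (1 : L) else 0)).Local v)]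
    [∀ a : ((UnitaryGroup.cmDatum L 2 (Matrix.of fun i j : Fin 2 => if i.val + j.val + 1 = 2 then (1 : L) else 0)).Local v × (UnitaryGroup.cmDatum L 1 (Matrix.of fun i j : Fin 1 => if i.val + j.val + 1 = 1 then (1 : L) else 0)).Local v), MeasurableSpace (((UnitaryGroup.cmDatum L 2 (Matrix.of fun i j : Fin 2 => if i.val + j.val + 1 = 2 then (1 : L) else 0)).Local v × (UnitaryGroup.cmDatum L 1 (Matrix.of fun i j : Fin 1 => if i.val + j.val + 1 = 1 then (1 : L) else 0)).Local v) ⧸ Subgroup.centralizer ({a} : Set ((UnitaryGroup.cmDatum L 2 (Matrix.of fun i j : Fin 2 => if i.val + j.val + 1 = 2 then (1 : L) else 0)).Local v × (UnitaryGroup.cmDatum L 1 (Matrix.of fun i j : Fin 1 => if i.val + j.val + 1 = 1 then (1 : L) else 0)).Local v)))]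
    (νH : Measure ((UnitaryGroup.cmDatum L 2 (Matrix.of fun i j : Fin 2 => if i.val + j.val + 1 = 2 then (1 : L) else 0)).Local v × (UnitaryGroup.cmDatum L 1 (Matrix.of fun i j : Fin 1 => if i.val + j.val + 1 = 1 then (1 : L) else 0)).Local v)) [νH.IsHaarMeasure]
    (νG₃ : Measure ((UnitaryGroup.cmDatum L 3 (Matrix.of fun i j : Fin 3 => if i.val + j.val + 1 = 3 then (1 : L) else 0)).Local v))
    (mH : OrbitalMeasureFamily ((UnitaryGroup.cmDatum L 2 (Matrix.of fun i j : Fin 2 => if i.val + j.val + 1 = 2 then (1 : L) else 0)).Local v × (UnitaryGroup.cmDatum L 1 (Matrix.of fun i j : Fin 1 => if i.val + j.val + 1 = 1 then (1 : L) else 0)).Local v)) (mG₃ : OrbitalMeasureFamily ((UnitaryGroup.cmDatum L 3 (Matrix.of fun i j : Fin 3 => if i.val + j.val + 1 = 3 then (1 : L) else 0)).Local v))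
    (Kt : Subgroup ((UnitaryGroup.cmDatum L 3 (Matrix.of fun i j : Fin 3 => if i.val + j.val + 1 = 3 then (1 : L) else 0)).Local v)) (C : ℂ)
    (h3a :
      ∃ V ∈ 𝓝 (1 : ((UnitaryGroup.cmDatum L 2 (Matrix.of fun i j : Fin 2 => if i.val + j.val + 1 = 2 then (1 : L) else 0)).Local v × (UnitaryGroup.cmDatum L 1 (Matrix.of fun i j : Fin 1 => if i.val + j.val + 1 = 1 then (1 : L) else 0)).Local v)),
        ∀ γH ∈ V, IsLocalGRegular L v γH →
        (∃ (y : ((UnitaryGroup.cmDatum L 2 (Matrix.of fun i j : Fin 2 => if i.val + j.val + 1 = 2 then (1 : L) else 0)).Local v × (UnitaryGroup.cmDatum L 1 (Matrix.of fun i j : Fin 1 => if i.val + j.val + 1 = 1 then (1 : L) else 0)).Local v)) (d' : Fin 2 → (UnitaryGroup.LocalRing L v)ˣ),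
            glDiagonal 2 (UnitaryGroup.LocalRing L v) d' = ((y * γH * y⁻¹).1.val : GL (Fin 2) (UnitaryGroup.LocalRing L v))) →
        ∑ᶠ c : ConjClasses ((UnitaryGroup.cmDatum L 3 (Matrix.of fun i j : Fin 3 => if i.val + j.val + 1 = 3 then (1 : L) else 0)).Local v), ((finExplicitCollection L (Matrix.of fun i j : Fin 3 => if i.val + j.val + 1 = 3 then (1 : L) else 0) μ (finExplicitDelta_conj_left_all L (Matrix.of fun i j : Fin 3 => if i.val + j.val + 1 = 3 then (1 : L) else 0) μ) (finExplicitDelta_conj_right_all L (Matrix.of fun i j : Fin 3 => if i.val + j.val + 1 = 3 then (1 : L) else 0) μ)) v).Δ γH (Quotient.out c) *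
            classOrbitalIntegral mG₃ (Set.indicator (Kt : Set ((UnitaryGroup.cmDatum L 3 (Matrix.of fun i j : Fin 3 => if i.val + j.val + 1 = 3 then (1 : L) else 0)).Local v)) (fun _ => (1 : ℂ))) c =
          ((νG₃.real (Kt : Set ((UnitaryGroup.cmDatum L 3 (Matrix.of fun i j : Fin 3 => if i.val + j.val + 1 = 3 then (1 : L) else 0)).Local v)) : ℂ) / (νH.real (((cmLocalIntegralLevel L 2 (Matrix.of fun i j : Fin 2 => if i.val + j.val + 1 = 2 then (1 : L) else 0) v).prod (cmLocalIntegralLevel L 1 (Matrix.of fun i j : Fin 1 => if i.val + j.val + 1 = 1 then (1 : L) else 0) v) : Subgroup _) : Set _) : ℂ)) *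
            stableOrbitalIntegralRel (IsLocalStablyConjH L v) mH (hFamily L w hw ϖ 0) γH)
    (h3b :
      ∃ V ∈ 𝓝 (1 : ((UnitaryGroup.cmDatum L 2 (Matrix.of fun i j : Fin 2 => if i.val + j.val + 1 = 2 then (1 : L) else 0)).Local v × (UnitaryGroup.cmDatum L 1 (Matrix.of fun i j : Fin 1 => if i.val + j.val + 1 = 1 then (1 : L) else 0)).Local v)),
        ∀ γH ∈ V, IsLocalGRegular L v γH →
        (∃ (y : ((UnitaryGroup.cmDatum L 2 (Matrix.of fun i j : Fin 2 => if i.val + j.val + 1 = 2 then (1 : L) else 0)).Local v × (UnitaryGroup.cmDatum L 1 (Matrix.of fun i j : Fin 1 => if i.val + j.val + 1 = 1 then (1 : L) else 0)).Local v)) (d' : Fin 2 → (UnitaryGroup.LocalRing L v)ˣ),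
            glDiagonal 2 (UnitaryGroup.LocalRing L v) d' = ((y * γH * y⁻¹).1.val : GL (Fin 2) (UnitaryGroup.LocalRing L v))) →
        (νH.real (Function.support (hFamily L w hw ϖ 0)) : ℂ) * stableOrbitalIntegralRel (IsLocalStablyConjH L v) mH (hFamily L w hw ϖ 1) γH =
          (νH.real (Function.support (hFamily L w hw ϖ 1)) : ℂ) * stableOrbitalIntegralRel (IsLocalStablyConjH L v) mH (hFamily L w hw ϖ 0) γH)
    (h3c : C = ((νG₃.real (Kt : Set ((UnitaryGroup.cmDatum L 3 (Matrix.of fun i j : Fin 3 => if i.val + j.val + 1 = 3 then (1 : L) else 0)).Local v)) : ℝ) : ℂ)) :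
      ∃ V ∈ 𝓝 (1 : ((UnitaryGroup.cmDatum L 2 (Matrix.of fun i j : Fin 2 => if i.val + j.val + 1 = 2 then (1 : L) else 0)).Local v × (UnitaryGroup.cmDatum L 1 (Matrix.of fun i j : Fin 1 => if i.val + j.val + 1 = 1 then (1 : L) else 0)).Local v)),
        ∀ γH ∈ V, IsLocalGRegular L v γH →
        (∃ (y : ((UnitaryGroup.cmDatum L 2 (Matrix.of fun i j : Fin 2 => if i.val + j.val + 1 = 2 then (1 : L) else 0)).Local v × (UnitaryGroup.cmDatum L 1 (Matrix.of fun i j : Fin 1 => if i.val + j.val + 1 = 1 then (1 : L) else 0)).Local v)) (d' : Fin 2 → (UnitaryGroup.LocalRing L v)ˣ),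
            glDiagonal 2 (UnitaryGroup.LocalRing L v) d' = ((y * γH * y⁻¹).1.val : GL (Fin 2) (UnitaryGroup.LocalRing L v))) →
        ∑ᶠ c : ConjClasses ((UnitaryGroup.cmDatum L 3 (Matrix.of fun i j : Fin 3 => if i.val + j.val + 1 = 3 then (1 : L) else 0)).Local v), ((finExplicitCollection L (Matrix.of fun i j : Fin 3 => if i.val + j.val + 1 = 3 then (1 : L) else 0) μ (finExplicitDelta_conj_left_all L (Matrix.of fun i j : Fin 3 => if i.val + j.val + 1 = 3 then (1 : L) else 0) μ) (finExplicitDelta_conj_right_all L (Matrix.of fun i j : Fin 3 => if i.val + j.val + 1 = 3 then (1 : L) else 0) μ)) v).Δ γH (Quotient.out c) *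
            classOrbitalIntegral mG₃ (Set.indicator (Kt : Set ((UnitaryGroup.cmDatum L 3 (Matrix.of fun i j : Fin 3 => if i.val + j.val + 1 = 3 then (1 : L) else 0)).Local v)) (fun _ => (1 : ℂ))) c =
          ∑ s, ((if ((s : Fin 2) : ℕ) = d % 2 then C * ((((Fintype.card (Valued.ResidueField (w.1.adicCompletion L)) : ℕ) : ℂ) + 1) - 2 * ((Fintype.card (Valued.ResidueField (w.1.adicCompletion L)) : ℕ) : ℂ) ^ (shiftR d tE)) else 2 * C * (((Fintype.card (Valued.ResidueField (w.1.adicCompletion L)) : ℕ) : ℂ) ^ (shiftR d tE) - 1)) / ((((Fintype.card (Valued.ResidueField (w.1.adicCompletion L)) : ℕ) : ℂ) - 1) * (νH.real (Function.support (hFamily L w hw ϖ s)) : ℂ))) * stableOrbitalIntegralRel (IsLocalStablyConjH L v) mH (hFamily L w hw ϖ s) γH := by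
  have hν0 := measureReal_support_hFamily_ne_zero L w hw he ϖ hϖ νH 0
  have hν1 := measureReal_support_hFamily_ne_zero L w hw he ϖ hϖ νH 1
  have hs0 := support_hFamily_zero L w hw ϖ
  rw [hs0] at hν0 h3b
  have hq : ((Fintype.card (Valued.ResidueField (w.1.adicCompletion L)) : ℕ) : ℂ) - 1 ≠ 0 := by
    haveI : Nontrivial (Valued.ResidueField (w.1.adicCompletion L)) := inferInstance
    exact sub_ne_zero.2 (by exact_mod_cast (Fintype.one_lt_card (α := Valued.ResidueField (w.1.adicCompletion L))).ne')
  refine exists_nhds_forall_eq_sum_two_of_ratio hν0 h3a h3b ?_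
  simp only [hs0]
  rw [← h3c]
  exact sum_coefStar_mul_eq hq hν0 hν1 d (shiftR d tE)

end Head

end Summit.HodgeConjecture.HodgeConjecture.Cruxes.H413.F0P3cDyRamRowThreeReduction

end
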